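import Mathlib.FieldTheory.Minpoly.Basic
import Mathlib.Algebra.Polynomial.Derivative
import Mathlib.RingTheory.IntegralClosure.Algebra.Basic
import HarnessLib

/-!
# Separability of integral elements in characteristic zero and the values where the derivative vanishes

Layer `Literature/RingTheory/IntegralClosure`. Two elementary facts about an integral extension
`R → A` of commutative rings with `A` a domain, used to bound the critical values of a finite
projection of an affine curve to the line (I. R. Shafarevich, *Basic Algebraic Geometry* (1974),
Ch. II §5.3, proof of Thm. 7: the unramified locus of a finite map in characteristic `0` through the
derivative of the minimal polynomial of an integral element):

* `aeval_derivative_minpoly_ne_zero` — if the positive integers are units of `R` (characteristic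
  zero, e.g. `R = k[t]`, `char k = 0`), the minimal polynomial `P` of an integral element `u` of a
  domain `A ⊇ R` satisfies `P'(u) ≠ 0` (else `P'/deg P` would be a monic polynomial of smaller degree
  vanishing at `u`);
* `exists_coeff_zero_ne_zero_and_eq_mul` — for a non-zero integral element `D` of a domain, the
  constant coefficient `b` of its minimal polynomial is non-zero and `b = D · E` in `A`;
* `exists_monic_derivative_dvd` — **consequence**: every `u` has a monic equation `P(u) = 0` over `R`
  and a NON-ZERO `b ∈ R` with `b ∈ P'(u) · A`; so at every ring homomorphism `χ : A → K` killing
  `P'(u)` the element `b` of `R` vanishes — over `R = ℂ[t]` the "critical values" `χ(t)` are roots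
  of the non-zero polynomial `b`, a finite set.

Everything is proved; there are no definitions.

## References

* I. R. Shafarevich, *Basic Algebraic Geometry*, Grundlehren 213, Springer (1974), Ch. II §5.3,
  Thm. 7 and its proof. [Shafarevich1974]
-/

open Polynomial

namespace Literature.RingTheory.IntegralClosure

variable {R A : Type*} [CommRing R] [CommRing A] [IsDomain A] [Algebra R A]

/-- **Separability in characteristic zero**: if the positive integers are units in `R`, the minimal
polynomial `P` of an integral element `u` of a domain satisfies `P'(u) ≠ 0`.
[cite: Shafarevich1974, Ch. II §5.3 Thm. 7 (proof)] -/
theorem aeval_derivative_minpoly_ne_zero (hunit : ∀ n : ℕ, n ≠ 0 → IsUnit (n : R)) {u : A}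
    (hu : IsIntegral R u) : aeval u (derivative (minpoly R u)) ≠ 0 := by
  intro h0
  haveI : Nontrivial R := (algebraMap R A).domain_nontrivial
  set P := minpoly R u with hP
  have hnpos : 0 < P.natDegree := minpoly.natDegree_pos hu
  obtain ⟨c, hc⟩ := hunit P.natDegree hnpos.ne'
  -- the monic polynomial `P' / deg P`
  set Q : R[X] := C (↑c⁻¹ : R) * derivative P with hQ
  have hQdeg : Q.natDegree ≤ P.natDegree - 1 :=
    (natDegree_C_mul_le _ _).trans (natDegree_derivative_le P)
  have hQcoeff : Q.coeff (P.natDegree - 1) = 1 := by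
    rw [hQ, coeff_C_mul, coeff_derivative, Nat.sub_add_cancel hnpos]
    have h1 : P.coeff P.natDegree = 1 := (minpoly.monic hu).coeff_natDegree
    rw [h1, one_mul]
    have h2 : ((P.natDegree - 1 : ℕ) : R) + 1 = (P.natDegree : R) := by
      have h := congrArg (Nat.cast (R := R)) (Nat.sub_add_cancel hnpos)
      push_cast at h
      exact h
    rw [h2, ← hc, Units.inv_mul]
  have hQmonic : Q.Monic := monic_of_natDegree_le_of_coeff_eq_one _ hQdeg hQcoeff
  have hQroot : aeval u Q = 0 := by
    rw [hQ, map_mul, aeval_C, h0, mul_zero]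
  have hmin := minpoly.min R u hQmonic hQroot
  have hdegQ : Q.degree ≤ (P.natDegree - 1 : ℕ) := degree_le_of_natDegree_le hQdeg
  have hdegP : P.degree = P.natDegree := degree_eq_natDegree (minpoly.ne_zero hu)
  rw [← hP, hdegP] at hmin
  have h := hmin.trans hdegQ
  rw [Nat.cast_le] at h
  omega

/-- **The constant coefficient of the minimal polynomial of a non-zero integral element of a domain
is non-zero, and is a multiple of the element**: `b ≠ 0` and `b = D · E`.
[folklore] -/
theorem exists_coeff_zero_ne_zero_and_eq_mul {D : A} (hD : IsIntegral R D) (hD0 : D ≠ 0) :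
    (minpoly R D).coeff 0 ≠ 0 ∧ ∃ E : A, algebraMap R A ((minpoly R D).coeff 0) = D * E := by
  haveI : Nontrivial R := (algebraMap R A).domain_nontrivial
  set Q := minpoly R D with hQ
  have hmonic : Q.Monic := minpoly.monic hD
  have hroot : aeval D Q = 0 := minpoly.aeval R D
  -- `Q - C (Q.coeff 0) = X * Q₁`
  obtain ⟨Q₁, hQ₁⟩ : X ∣ Q - C (Q.coeff 0) := by
    rw [X_dvd_iff]
    simp
  have hE : algebraMap R A (Q.coeff 0) = D * (-aeval D Q₁) := by
    have h := congr_arg (aeval D) hQ₁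
    rw [map_sub, hroot, aeval_C, zero_sub, map_mul, aeval_X] at h
    rw [mul_neg, ← h, neg_neg]
  refine ⟨fun h0 ↦ ?_, -aeval D Q₁, hE⟩
  -- if the constant coefficient vanished, `Q = X * Q₁` with `Q₁` monic of smaller degree killing `D`
  rw [h0, C_0, sub_zero] at hQ₁
  have hQ₁monic : Q₁.Monic := Monic.of_mul_monic_left monic_X (hQ₁ ▸ hmonic)
  have hQ₁root : aeval D Q₁ = 0 := by
    have h := hroot
    rw [hQ₁, map_mul, aeval_X] at h
    exact (mul_eq_zero.1 h).resolve_left hD0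
  have hmin := minpoly.min R D hQ₁monic hQ₁root
  rw [← hQ] at hmin
  have hQ₁ne : Q₁ ≠ 0 := hQ₁monic.ne_zero
  have hnat : Q.natDegree = 1 + Q₁.natDegree := by
    rw [hQ₁, monic_X.natDegree_mul hQ₁monic, natDegree_X]
  rw [degree_eq_natDegree hmonic.ne_zero, degree_eq_natDegree hQ₁ne, Nat.cast_le, hnat] at hmin
  omega

/-- **Monic equation and critical element.** Let `R → A` be integral with `A` a domain and the
positive integers units in `R`. Every `u ∈ A` satisfies a monic equation `P(u) = 0` over `R` for which
some NON-ZERO `b ∈ R` lies in `P'(u) · A`; in particular every ring homomorphism out of `A` killing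
`P'(u)` kills `b` (for `R = k[t]`: the "critical values" are roots of `b ≠ 0`).
[cite: Shafarevich1974, Ch. II §5.3 Thm. 7 (proof)] -/
theorem exists_monic_derivative_dvd [Algebra.IsIntegral R A] (hunit : ∀ n : ℕ, n ≠ 0 → IsUnit (n : R)) (u : A) :
    ∃ (P : R[X]) (b : R) (E : A), P.Monic ∧ aeval u P = 0 ∧ b ≠ 0 ∧
      algebraMap R A b = aeval u (derivative P) * E := by
  have hu : IsIntegral R u := Algebra.IsIntegral.isIntegral u
  have hD0 := aeval_derivative_minpoly_ne_zero hunit hu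
  have hD : IsIntegral R (aeval u (derivative (minpoly R u))) := Algebra.IsIntegral.isIntegral _
  obtain ⟨hb, E, hE⟩ := exists_coeff_zero_ne_zero_and_eq_mul hD hD0
  exact ⟨minpoly R u, _, E, minpoly.monic hu, minpoly.aeval R u, hb, hE⟩

end Literature.RingTheory.IntegralClosure
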